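import Mathlib
import Summits.MatrixMultiplication.MatrixMultiplication.Theses.LevelGradedCohnUmans
import Summits.MatrixMultiplication.MatrixMultiplication.Theorems.SnLevelDesigns.Negative.DimensionWalls
import Summits.MatrixMultiplication.MatrixMultiplication.Theorems.SnLevelDesigns.Negative.DeadCorners
import Summits.MatrixMultiplication.MatrixMultiplication.Theorems.LevelGradedCohnUmansTokenWall

/-!
# `SnLevelDesigns` (stmt-MatrixMultiplication-7613), line `garnir-annihilator`:
# K2 `stub_twoSetCore` — the two-set core is necessary at the near-wall scale

Crux `Summit.MatrixMultiplication.MatrixMultiplication.Theses.LevelGradedCohnUmans.SnLevelDesigns`;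
skeleton `Cruxes/SnLevelDesigns/Lines/garnir_annihilator.lean` (lead c2 reshape 5, registered stub K2);
this file proves the registered stub `stub_twoSetCore` verbatim (name + signature, tree-only
vocabulary) and lands `--supports stmt-MatrixMultiplication-7613`.

Write `D = D_k(n) = ∑_{μ ⊢ n, μ₁ ≥ n-k} (f^μ)²` for the level-`k` budget and `Sep(X, Y, Z)` for the
crux's `k`-token separation clause. If a family `P` of separated triples reaches the near-wall scale
`D^{3/2} ≤ e^{δ√k} |X||Y||Z|` for every `δ > 0` at arbitrarily large `k` (with `3k ≤ n`), then
collapsing the middle set (`y = y'`) leaves, for every `δ > 0` and arbitrarily large `k`, a PAIR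
`(X, Z)` that is separated against the middle set `{1}` with `D ≤ e^{δ√k} |X||Z|` and
`|X|, |Z| ≤ e^{δ√k} √D`.

Proof. Apply the family hypothesis with `δ/2`; put `E = e^{(δ/2)√k}` (so `e^{δ√k} = E·E`),
`a = |X|`, `b = |Y|`, `c = |Z|`, `V = abc`.
* `1 ≤ D` (`tsc_one_le_budget`: the partition `(n)` has `μ₁ = n ≥ n - k`
  (`Negative.indiscrete_sup_ge`) and `f^μ ≥ 1` (`numStandardTableaux_pos_holds`)), so
  `D^{3/2} > 0` forces `V ≠ 0`: `X, Y, Z ≠ ∅`.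
* The three dimension walls (`Negative.card_X_mul_card_Y_le_finrank`, `…_Y_mul_card_Z_…`,
  `…_X_mul_card_Z_…`, file `DimensionWalls.lean`) and `dim T_k ≤ D`
  (`LevelGradedCohnUmansTokenWall.finrank_tokenSpace_le`) give `ab, bc, ac ≤ D`.
* Arithmetic (`tsc_arith`, with `s = √D`): `V² = (ab)(bc)(ac) ≤ D²·ac` and `D³ ≤ E²V²` give
  `D ≤ E²·ac`; `a·V = (ab)(ac) ≤ D²` and `D^{3/2} ≤ E·V` give `a ≤ E√D ≤ E²√D`; same for `c`.
* Separation of the pair (`tsc_pairSep`): the separator of `(x₀, z₀)` works, since for a fixed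
  `y₁ ∈ Y` the products `x⁻¹ y₁ y₁⁻¹ z` and `x⁻¹ · 1 · 1⁻¹ · z` are both `x⁻¹ z` and the patterns
  `[x = x₀ ∧ y₁ = y₁ ∧ z = z₀]`, `[x = x₀ ∧ 1 = 1 ∧ z = z₀]` agree.
-/

-- the problem path repeats `MatrixMultiplication` (summit = problem), as in every file of this line
set_option linter.dupNamespace false

namespace Summit.MatrixMultiplication.MatrixMultiplication.Theorems.SnLevelDesigns

open scoped BigOperators
open Literature.NumberTheory.DiophantineGeometry (numStandardTableaux numStandardTableaux_pos_holds)

/-- The level-`k` budget is at least `1`: the one-row partition `(n)` has first part `n ≥ n - k`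
and every shape carries a standard tableau (`f^μ ≥ 1`). -/
theorem tsc_one_le_budget (n k : ℕ) :
    1 ≤ ∑ μ : Nat.Partition n, if n - k ≤ μ.parts.sup then numStandardTableaux μ ^ 2 else 0 := by
  have hterm : 1 ≤ (if n - k ≤ (Nat.Partition.indiscrete n).parts.sup then
      numStandardTableaux (Nat.Partition.indiscrete n) ^ 2 else 0) := by
    rw [if_pos (Negative.indiscrete_sup_ge n k)]
    exact Nat.one_le_pow _ _ (numStandardTableaux_pos_holds (Nat.Partition.indiscrete n))
  exact hterm.trans (Finset.single_le_sum (f := fun μ : Nat.Partition n =>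
    if n - k ≤ μ.parts.sup then numStandardTableaux μ ^ 2 else 0) (fun μ _ => Nat.zero_le _)
    (Finset.mem_univ _))

/-- The real arithmetic of the two-set core, in terms of `s = √D`: from `s³ ≤ E·abc` and the three
walls `ab, bc, ac ≤ s²` (with `a, b, c ≥ 0`, `s > 0`, `E ≥ 1`) one gets `s² ≤ E²·ac`,
`a ≤ E²·s` and `c ≤ E²·s`. -/
theorem tsc_arith_sq {s E a b c : ℝ} (hs : 0 < s) (hE : 1 ≤ E) (ha : 0 ≤ a) (hb : 0 ≤ b)
    (hc : 0 ≤ c) (hvol : s ^ 3 ≤ E * (a * b * c)) (hab : a * b ≤ s ^ 2) (hbc : b * c ≤ s ^ 2)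
    (hac : a * c ≤ s ^ 2) :
    s ^ 2 ≤ E * E * (a * c) ∧ a ≤ E * E * s ∧ c ≤ E * E * s := by
  have hE0 : 0 ≤ E := zero_le_one.trans hE
  have hs2 : 0 < s ^ 2 := pow_pos hs 2
  have hs3 : 0 < s ^ 3 := pow_pos hs 3
  have hEs : E * s ≤ E * E * s := by
    rw [mul_assoc]
    exact le_mul_of_one_le_left (mul_nonneg hE0 hs.le) hE
  refine ⟨?_, ?_, ?_⟩
  · -- `s⁶ ≤ E² (abc)² = E² (ab)(bc)(ac) ≤ E² s⁴ (ac)`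
    have h1 : (a * b * c) ^ 2 ≤ s ^ 2 * s ^ 2 * (a * c) := by
      calc (a * b * c) ^ 2 = (a * b) * (b * c) * (a * c) := by ring
        _ ≤ s ^ 2 * s ^ 2 * (a * c) :=
          mul_le_mul_of_nonneg_right (mul_le_mul hab hbc (mul_nonneg hb hc) hs2.le)
            (mul_nonneg ha hc)
    have h3 : s ^ 2 * (s ^ 2 * s ^ 2) ≤ E * E * (a * c) * (s ^ 2 * s ^ 2) := by
      calc s ^ 2 * (s ^ 2 * s ^ 2) = (s ^ 3) ^ 2 := by ring
        _ ≤ (E * (a * b * c)) ^ 2 := pow_le_pow_left₀ hs3.le hvol 2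
        _ = E * E * (a * b * c) ^ 2 := by ring
        _ ≤ E * E * (s ^ 2 * s ^ 2 * (a * c)) :=
          mul_le_mul_of_nonneg_left h1 (mul_nonneg hE0 hE0)
        _ = E * E * (a * c) * (s ^ 2 * s ^ 2) := by ring
    exact le_of_mul_le_mul_right h3 (mul_pos hs2 hs2)
  · -- `a s³ ≤ a E (abc) = E (ab)(ac) ≤ E s⁴`
    have h1 : a * (a * b * c) ≤ s ^ 2 * s ^ 2 := by
      calc a * (a * b * c) = (a * b) * (a * c) := by ring
        _ ≤ s ^ 2 * s ^ 2 := mul_le_mul hab hac (mul_nonneg ha hc) hs2.le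
    have h2 : a * s ^ 3 ≤ E * s * s ^ 3 := by
      calc a * s ^ 3 ≤ a * (E * (a * b * c)) := mul_le_mul_of_nonneg_left hvol ha
        _ = E * (a * (a * b * c)) := by ring
        _ ≤ E * (s ^ 2 * s ^ 2) := mul_le_mul_of_nonneg_left h1 hE0
        _ = E * s * s ^ 3 := by ring
    exact (le_of_mul_le_mul_right h2 hs3).trans hEs
  · -- `c s³ ≤ c E (abc) = E (ac)(bc) ≤ E s⁴`
    have h1 : c * (a * b * c) ≤ s ^ 2 * s ^ 2 := by
      calc c * (a * b * c) = (a * c) * (b * c) := by ring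
        _ ≤ s ^ 2 * s ^ 2 := mul_le_mul hac hbc (mul_nonneg hb hc) hs2.le
    have h2 : c * s ^ 3 ≤ E * s * s ^ 3 := by
      calc c * s ^ 3 ≤ c * (E * (a * b * c)) := mul_le_mul_of_nonneg_left hvol hc
        _ = E * (c * (a * b * c)) := by ring
        _ ≤ E * (s ^ 2 * s ^ 2) := mul_le_mul_of_nonneg_left h1 hE0
        _ = E * s * s ^ 3 := by ring
    exact (le_of_mul_le_mul_right h2 hs3).trans hEs

/-- The real arithmetic of the two-set core: from `D ≥ 1`, `E ≥ 1`, `a, b, c ≥ 0`,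
`D^{3/2} ≤ E·abc` and the three walls `ab, bc, ac ≤ D` one gets `D ≤ E²·ac`, `a ≤ E²·√D` and
`c ≤ E²·√D` (`tsc_arith_sq` with `s = √D`, `D = s²`, `D^{3/2} = s³`). -/
theorem tsc_arith {D E a b c : ℝ} (hD : 1 ≤ D) (hE : 1 ≤ E) (ha : 0 ≤ a) (hb : 0 ≤ b)
    (hc : 0 ≤ c) (hvol : D ^ ((3 : ℝ) / 2) ≤ E * (a * b * c)) (hab : a * b ≤ D) (hbc : b * c ≤ D)
    (hac : a * c ≤ D) :
    D ≤ E * E * (a * c) ∧ a ≤ E * E * Real.sqrt D ∧ c ≤ E * E * Real.sqrt D := by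
  have hD0 : 0 ≤ D := zero_le_one.trans hD
  have hs : 0 < Real.sqrt D := Real.sqrt_pos.2 (zero_lt_one.trans_le hD)
  have hDs : D = Real.sqrt D ^ 2 := (Real.sq_sqrt hD0).symm
  rw [Real.rpow_div_two_eq_sqrt _ hD0, Real.rpow_ofNat] at hvol
  rw [hDs] at hab hbc hac
  have h := tsc_arith_sq hs hE ha hb hc hvol hab hbc hac
  rw [← hDs] at h
  exact h

/-- Collapse of the middle set: if `(X, Y, Z)` is `k`-token separated and `Y ≠ ∅`, then
`(X, {1}, Z)` is `k`-token separated, by the same separators — for a fixed `y₁ ∈ Y` the products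
`x⁻¹ y₁ y₁⁻¹ z` and `x⁻¹ · 1 · 1⁻¹ · z` are both `x⁻¹ z`, and the required patterns agree. -/
theorem tsc_pairSep {n k : ℕ} {X Y Z : Finset (Equiv.Perm (Fin n))}
    (h : ∀ x₀ ∈ X, ∀ z₀ ∈ Z, ∃ c : (Fin k → Fin n) → (Fin k → Fin n) → ℂ, ∀ x ∈ X, ∀ y ∈ Y,
      ∀ y' ∈ Y, ∀ z ∈ Z, (∑ p : Fin k → Fin n, c p (⇑(x⁻¹ * y * y'⁻¹ * z) ∘ p)) =
        if x = x₀ ∧ y = y' ∧ z = z₀ then 1 else 0) (hY : Y.Nonempty) :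
    ∀ x₀ ∈ X, ∀ z₀ ∈ Z, ∃ c : (Fin k → Fin n) → (Fin k → Fin n) → ℂ,
      ∀ x ∈ X, ∀ y ∈ ({1} : Finset (Equiv.Perm (Fin n))),
        ∀ y' ∈ ({1} : Finset (Equiv.Perm (Fin n))), ∀ z ∈ Z,
          (∑ p : Fin k → Fin n, c p (⇑(x⁻¹ * y * y'⁻¹ * z) ∘ p)) =
            if x = x₀ ∧ y = y' ∧ z = z₀ then 1 else 0 := by
  obtain ⟨y₁, hy₁⟩ := hY
  intro x₀ hx₀ z₀ hz₀
  obtain ⟨c, hc⟩ := h x₀ hx₀ z₀ hz₀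
  refine ⟨c, fun x hx y hy y' hy' z hz => ?_⟩
  rw [Finset.mem_singleton] at hy hy'
  subst hy
  subst hy'
  have h1 := hc x hx y₁ hy₁ y₁ hy₁ z hz
  rw [mul_inv_cancel_right] at h1
  rw [mul_one, inv_one, mul_one, h1]
  by_cases hxz : x = x₀ ∧ z = z₀
  · rw [if_pos ⟨hxz.1, rfl, hxz.2⟩, if_pos ⟨hxz.1, rfl, hxz.2⟩]
  · rw [if_neg (fun h' => hxz ⟨h'.1, h'.2.2⟩), if_neg (fun h' => hxz ⟨h'.1, h'.2.2⟩)]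

/-- **`stub_twoSetCore`** (registered stub K2 of crux stmt-MatrixMultiplication-7613, line
`garnir-annihilator`; the two-set core is necessary at the near-wall scale). If `P` is a family of
`k`-token separated triples `(X, Y, Z) ⊆ 𝔖ₙ³` which, for every `δ > 0`, reaches
`D_k(n)^{3/2} ≤ e^{δ√k} |X||Y||Z|` at arbitrarily large `k` with `3k ≤ n`
(`D_k(n) = ∑_{μ₁ ≥ n-k} (f^μ)²`), then for every `δ > 0` and arbitrarily large `k` there are
`n ≥ 3k` and a pair `(X, Z)` separated against the middle set `{1}` with
`D_k(n) ≤ e^{δ√k} |X||Z|` and `|X|, |Z| ≤ e^{δ√k} √(D_k(n))`. Proof: apply the hypothesis with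
`δ/2`; `D ≥ 1` (`tsc_one_le_budget`) forces `X, Y, Z ≠ ∅`; the dimension walls
(`Negative.card_X_mul_card_Y_le_finrank` etc.) and `dim T_k ≤ D`
(`LevelGradedCohnUmansTokenWall.finrank_tokenSpace_le`) give `ab, bc, ac ≤ D`; conclude with
`tsc_arith` and `tsc_pairSep`. -/
theorem stub_twoSetCore :
    ∀ P : (n : ℕ) → ℕ → Finset (Equiv.Perm (Fin n)) → Finset (Equiv.Perm (Fin n)) →
        Finset (Equiv.Perm (Fin n)) → Prop,
      (∀ (n k : ℕ) (X Y Z : Finset (Equiv.Perm (Fin n))), P n k X Y Z →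
          ∀ x₀ ∈ X, ∀ z₀ ∈ Z, ∃ c : (Fin k → Fin n) → (Fin k → Fin n) → ℂ,
            ∀ x ∈ X, ∀ y ∈ Y, ∀ y' ∈ Y, ∀ z ∈ Z,
              (∑ p : Fin k → Fin n, c p (⇑(x⁻¹ * y * y'⁻¹ * z) ∘ p)) = if x = x₀ ∧ y = y' ∧ z = z₀ then 1 else 0) →
      (∀ δ : ℝ, 0 < δ → ∀ k₀ : ℕ, ∃ k : ℕ, k₀ ≤ k ∧ ∃ (n : ℕ) (X Y Z : Finset (Equiv.Perm (Fin n))),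
          3 * k ≤ n ∧ P n k X Y Z ∧
            ((∑ μ : Nat.Partition n, if n - k ≤ μ.parts.sup then
                Literature.NumberTheory.DiophantineGeometry.numStandardTableaux μ ^ 2 else 0 : ℕ) : ℝ) ^ ((3 : ℝ) / 2) ≤
              Real.exp (δ * Real.sqrt (k : ℝ)) * ((X.card * Y.card * Z.card : ℕ) : ℝ)) →
      ∀ δ : ℝ, 0 < δ → ∀ k₀ : ℕ, ∃ k : ℕ, k₀ ≤ k ∧ ∃ (n : ℕ) (X Z : Finset (Equiv.Perm (Fin n))),
        3 * k ≤ n ∧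
          (∀ x₀ ∈ X, ∀ z₀ ∈ Z, ∃ c : (Fin k → Fin n) → (Fin k → Fin n) → ℂ,
            ∀ x ∈ X, ∀ y ∈ ({1} : Finset (Equiv.Perm (Fin n))), ∀ y' ∈ ({1} : Finset (Equiv.Perm (Fin n))),
              ∀ z ∈ Z, (∑ p : Fin k → Fin n, c p (⇑(x⁻¹ * y * y'⁻¹ * z) ∘ p)) =
                if x = x₀ ∧ y = y' ∧ z = z₀ then 1 else 0) ∧
          ((∑ μ : Nat.Partition n, if n - k ≤ μ.parts.sup then
              Literature.NumberTheory.DiophantineGeometry.numStandardTableaux μ ^ 2 else 0 : ℕ) : ℝ) ≤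
            Real.exp (δ * Real.sqrt (k : ℝ)) * ((X.card * Z.card : ℕ) : ℝ) ∧
          ((X.card : ℕ) : ℝ) ≤ Real.exp (δ * Real.sqrt (k : ℝ)) *
            Real.sqrt ((∑ μ : Nat.Partition n, if n - k ≤ μ.parts.sup then
              Literature.NumberTheory.DiophantineGeometry.numStandardTableaux μ ^ 2 else 0 : ℕ) : ℝ) ∧
          ((Z.card : ℕ) : ℝ) ≤ Real.exp (δ * Real.sqrt (k : ℝ)) *
            Real.sqrt ((∑ μ : Nat.Partition n, if n - k ≤ μ.parts.sup then
              Literature.NumberTheory.DiophantineGeometry.numStandardTableaux μ ^ 2 else 0 : ℕ) : ℝ) := by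
  intro P hSep hNW δ hδ k₀
  obtain ⟨k, hk, n, X, Y, Z, h3k, hP, hvol⟩ := hNW (δ / 2) (half_pos hδ) k₀
  have hsep := hSep n k X Y Z hP
  -- `1 ≤ D`
  have hD1 : (1 : ℝ) ≤ ((∑ μ : Nat.Partition n, if n - k ≤ μ.parts.sup then
      numStandardTableaux μ ^ 2 else 0 : ℕ) : ℝ) :=
    Nat.one_le_cast.2 (tsc_one_le_budget n k)
  -- the three sets are nonempty
  have hV : X.card * Y.card * Z.card ≠ 0 := by
    intro h0
    rw [h0, Nat.cast_zero, mul_zero] at hvol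
    exact absurd hvol (not_le.2 (Real.rpow_pos_of_pos (zero_lt_one.trans_le hD1) _))
  obtain ⟨hXY0, hZ0⟩ := mul_ne_zero_iff.1 hV
  obtain ⟨hX0, hY0⟩ := mul_ne_zero_iff.1 hXY0
  have hXne : X.Nonempty := Finset.card_ne_zero.1 hX0
  have hYne : Y.Nonempty := Finset.card_ne_zero.1 hY0
  have hZne : Z.Nonempty := Finset.card_ne_zero.1 hZ0
  -- the three walls, through `dim T_k ≤ D`
  have hTD := LevelGradedCohnUmansTokenWall.finrank_tokenSpace_le n k
  have hw1 := (Negative.card_X_mul_card_Y_le_finrank hsep hZne).trans hTD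
  have hw2 := (Negative.card_Y_mul_card_Z_le_finrank hsep hXne).trans hTD
  have hw3 := (Negative.card_X_mul_card_Z_le_finrank hsep hYne).trans hTD
  -- arithmetic, with `E = e^{(δ/2)√k}` and `e^{δ√k} = E·E`
  have hE : (1 : ℝ) ≤ Real.exp (δ / 2 * Real.sqrt (k : ℝ)) :=
    Real.one_le_exp (mul_nonneg (half_pos hδ).le (Real.sqrt_nonneg _))
  have hEE : Real.exp (δ * Real.sqrt (k : ℝ)) =
      Real.exp (δ / 2 * Real.sqrt (k : ℝ)) * Real.exp (δ / 2 * Real.sqrt (k : ℝ)) := by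
    rw [← Real.exp_add]
    congr 1
    ring
  rw [Nat.cast_mul, Nat.cast_mul] at hvol
  obtain ⟨i1, i2, i3⟩ := tsc_arith hD1 hE (Nat.cast_nonneg _) (Nat.cast_nonneg _)
    (Nat.cast_nonneg _) hvol (by exact_mod_cast hw1) (by exact_mod_cast hw2)
    (by exact_mod_cast hw3)
  refine ⟨k, hk, n, X, Z, h3k, tsc_pairSep hsep hYne, ?_, ?_, ?_⟩
  · rw [hEE, Nat.cast_mul]
    exact i1
  · rw [hEE]
    exact i2
  · rw [hEE]
    exact i3

end Summit.MatrixMultiplication.MatrixMultiplication.Theorems.SnLevelDesigns
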